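import Mathlib
import Literature.Analysis.FluidPDE.VectorCalculus
import Summits.NavierStokesRegularity.NavierStokesRegularity.Theses.IsobarTomography

/-!
# Route `IsobarTomography`, support item `FlatBochnerDivergence` (stmt-NavierStokesRegularity-11742)

The pointwise flat Bochner / Reilly identity: for a `C³` scalar field `p` on a
finite-dimensional real inner product space (in particular on `ℝ³ = EuclideanSpace ℝ (Fin 3)`)
and every point `x`,

`div (Δp ∇p − ∇²p ∇p)(x) = (Δp(x))² − |∇²p(x)|²_F`,

where `∇²p ∇p = D(∇p)[∇p]`, `|·|_F` is the Frobenius norm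
(`Literature.Analysis.FluidPDE.frobeniusNormSq`) and `div` is the trace of the Fréchet derivative
(`Literature.Analysis.FluidPDE.VectorCalculus.divergence`).

Proof (coordinate-free). Write `g = ∇p`, `H = Dg` and `G = D²g(x)`. Then
* `D(Δp • g)(x) v = (DΔp(x) v) g(x) + Δp(x) H(x) v`, whose trace is `DΔp(x)[g x] + (Δp x)²`
  (using `Δp = Σᵢ ⟪eᵢ, H eᵢ⟫`);
* `D(y ↦ H(y) g(y))(x) v = G[v] (g x) + H(x) (H(x) v)`, whose trace is
  `Σᵢ ⟪eᵢ, G[eᵢ] (g x)⟫ + Σᵢ ‖H eᵢ‖²` (self-adjointness of the Hessian `H(x)`);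
* `DΔp(x)[g x] = Σᵢ ⟪eᵢ, G[g x] eᵢ⟫ = Σᵢ ⟪eᵢ, G[eᵢ] (g x)⟫` by the symmetry of the second
  derivative `G` of the `C²` map `g` (this is where `p ∈ C³` is used).
Subtracting gives the identity. The gradient is handled through an honest `ℝ`-linear copy of
`(InnerProductSpace.toDual ℝ E).symm`.

References: R. C. Reilly, Indiana Univ. Math. J. 26 (1977) 459–472 (the integrated form);
the pointwise identity is folklore (flat case of the Bochner formula).
-/

open scoped InnerProductSpace

-- the problem directory repeats the summit name (`NavierStokesRegularity/NavierStokesRegularity`)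
set_option linter.dupNamespace false

namespace Summit.NavierStokesRegularity.NavierStokesRegularity.Theorems

/-- **Flat Bochner / Reilly pointwise identity** on a finite-dimensional real inner product
space: for `p ∈ C³` and every `x`,
`div (Δp ∇p − D(∇p)[∇p])(x) = (Δp x)² − |D(∇p)(x)|²_F`. [folklore] -/
theorem divergence_laplacian_smul_gradient_sub_hessian_apply_gradient
    {E : Type*} [NormedAddCommGroup E] [InnerProductSpace ℝ E] [FiniteDimensional ℝ E]
    [CompleteSpace E] (p : E → ℝ) (hp : ContDiff ℝ 3 p) (x : E) :
    Literature.Analysis.FluidPDE.VectorCalculus.divergence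
        (fun y => Laplacian.laplacian p y • gradient p y
          - (fderiv ℝ (gradient p) y) (gradient p y)) x =
      (Laplacian.laplacian p x) ^ 2
        - Literature.Analysis.FluidPDE.frobeniusNormSq (fderiv ℝ (gradient p) x) := by
  set b := stdOrthonormalBasis ℝ E with hb_def
  -- Step 0: an honest `ℝ`-linear copy `T` of the Riesz isomorphism `(toDual ℝ E).symm`.
  obtain ⟨T, hT⟩ : ∃ T : (E →L[ℝ] ℝ) →L[ℝ] E,
      ∀ φ, T φ = (InnerProductSpace.toDual ℝ E).symm φ :=
    ⟨{ toFun := fun φ => (InnerProductSpace.toDual ℝ E).symm φ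
       map_add' := fun φ ψ => map_add _ φ ψ
       map_smul' := fun c φ => by simp
       cont := (InnerProductSpace.toDual ℝ E).symm.continuous }, fun _ => rfl⟩
  have hTin : ∀ (φ : E →L[ℝ] ℝ) (v : E), ⟪v, T φ⟫_ℝ = φ v := fun φ v => by
    rw [hT, real_inner_comm, InnerProductSpace.toDual_symm_apply]
  -- Step 1: `gradient p = T ∘ fderiv p`, hence `C²`.
  have hg_eq : gradient p = fun y => T (fderiv ℝ p y) := by
    funext y; rw [hT]; rfl
  have hd1 : ContDiff ℝ 2 (fderiv ℝ p) := hp.fderiv_right (by norm_num)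
  have hgC2 : ContDiff ℝ 2 (gradient p) := by
    rw [hg_eq]; exact T.contDiff.comp hd1
  -- Step 2: the Hessian `H y = fderiv ℝ (gradient p) y` satisfies `⟪w, H y v⟫ = D²p(y)[v, w]`.
  have hH : ∀ y, fderiv ℝ (gradient p) y = T.comp (fderiv ℝ (fderiv ℝ p) y) := fun y => by
    rw [hg_eq]
    exact (T.hasFDerivAt.comp y ((hd1.differentiable (by simp)) y).hasFDerivAt).fderiv
  have hHin : ∀ y v w, ⟪w, fderiv ℝ (gradient p) y v⟫_ℝ = fderiv ℝ (fderiv ℝ p) y v w := by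
    intro y v w; rw [hH, ContinuousLinearMap.comp_apply, hTin]
  have hd2sym : ∀ y v w, fderiv ℝ (fderiv ℝ p) y v w = fderiv ℝ (fderiv ℝ p) y w v :=
    fun y v w =>
      (hp.contDiffAt.isSymmSndFDerivAt
        (by rw [minSmoothness_of_isRCLikeNormedField]; norm_num)) v w
  -- self-adjointness of the Hessian
  have hHsa : ∀ y v w,
      ⟪w, fderiv ℝ (gradient p) y v⟫_ℝ = ⟪v, fderiv ℝ (gradient p) y w⟫_ℝ := by
    intro y v w; rw [hHin, hHin, hd2sym]
  -- Step 3: the Laplacian is the trace of the Hessian.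
  have hL : Laplacian.laplacian p = fun y => ∑ i, ⟪b i, fderiv ℝ (gradient p) y (b i)⟫_ℝ := by
    rw [InnerProductSpace.laplacian_eq_iteratedFDeriv_stdOrthonormalBasis]
    funext y
    refine Finset.sum_congr rfl fun i _ => ?_
    simp only [iteratedFDeriv_two_apply, Matrix.cons_val_zero, Matrix.cons_val_one, hHin,
      hb_def]
  -- Step 4: derivatives at `x`.
  have hgx : HasFDerivAt (gradient p) (fderiv ℝ (gradient p) x) x :=
    ((hgC2.differentiable (by simp)) x).hasFDerivAt
  have hHC1 : ContDiff ℝ 1 (fderiv ℝ (gradient p)) := hgC2.fderiv_right (by norm_num)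
  have hHx : HasFDerivAt (fderiv ℝ (gradient p)) (fderiv ℝ (fderiv ℝ (gradient p)) x) x :=
    ((hHC1.differentiable (by simp)) x).hasFDerivAt
  have hG2sym : ∀ v w, fderiv ℝ (fderiv ℝ (gradient p)) x v w
      = fderiv ℝ (fderiv ℝ (gradient p)) x w v :=
    fun v w => (hgC2.contDiffAt.isSymmSndFDerivAt (by simp)) v w
  -- derivative of the Laplacian
  obtain ⟨L', hL'v, hLx⟩ : ∃ L' : E →L[ℝ] ℝ,
      (∀ v, L' v = ∑ j, ⟪b j, fderiv ℝ (fderiv ℝ (gradient p)) x v (b j)⟫_ℝ) ∧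
        HasFDerivAt (Laplacian.laplacian p) L' x := by
    refine ⟨∑ j, (innerSL ℝ (b j)).comp ((fderiv ℝ (fderiv ℝ (gradient p)) x).flip (b j)),
      fun v => ?_, ?_⟩
    · simp
    · rw [hL]
      apply HasFDerivAt.fun_sum
      intro i _
      have h1 : HasFDerivAt (fun y => fderiv ℝ (gradient p) y (b i))
          ((fderiv ℝ (fderiv ℝ (gradient p)) x).flip (b i)) x := by
        simpa using hHx.clm_apply (hasFDerivAt_const (b i) x)
      exact (innerSL ℝ (b i)).hasFDerivAt.comp x h1
  -- derivative of the vector field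
  have hV : HasFDerivAt
      (fun y => Laplacian.laplacian p y • gradient p y
        - (fderiv ℝ (gradient p) y) (gradient p y))
      ((Laplacian.laplacian p x • fderiv ℝ (gradient p) x + L'.smulRight (gradient p x))
        - ((fderiv ℝ (gradient p) x).comp (fderiv ℝ (gradient p) x)
          + (fderiv ℝ (fderiv ℝ (gradient p)) x).flip (gradient p x))) x :=
    (hLx.fun_smul hgx).fun_sub (hHx.clm_apply hgx)
  -- Step 5: take the trace.
  rw [Literature.Analysis.FluidPDE.divergence_eq_sum_inner_fderiv b, hV.fderiv,
    Literature.Analysis.FluidPDE.frobeniusNormSq_eq_sum b]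
  have hLsumx : Laplacian.laplacian p x = ∑ i, ⟪b i, fderiv ℝ (gradient p) x (b i)⟫_ℝ :=
    congrFun hL x
  have key : ∀ i, ⟪b i, ((Laplacian.laplacian p x • fderiv ℝ (gradient p) x
        + L'.smulRight (gradient p x))
        - ((fderiv ℝ (gradient p) x).comp (fderiv ℝ (gradient p) x)
          + (fderiv ℝ (fderiv ℝ (gradient p)) x).flip (gradient p x))) (b i)⟫_ℝ
      = Laplacian.laplacian p x * ⟪b i, fderiv ℝ (gradient p) x (b i)⟫_ℝ
        + L' (b i) * ⟪b i, gradient p x⟫_ℝ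
        - (‖fderiv ℝ (gradient p) x (b i)‖ ^ 2
          + ⟪b i, fderiv ℝ (fderiv ℝ (gradient p)) x (b i) (gradient p x)⟫_ℝ) := by
    intro i
    rw [sub_apply, add_apply, add_apply, smul_apply, ContinuousLinearMap.smulRight_apply,
      ContinuousLinearMap.comp_apply,
      ContinuousLinearMap.flip_apply, inner_sub_right, inner_add_right, inner_add_right,
      real_inner_smul_right, real_inner_smul_right,
      hHsa x (fderiv ℝ (gradient p) x (b i)) (b i), real_inner_self_eq_norm_sq]
  have hcancel : ∑ i, L' (b i) * ⟪b i, gradient p x⟫_ℝ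
      = ∑ i, ⟪b i, fderiv ℝ (fderiv ℝ (gradient p)) x (b i) (gradient p x)⟫_ℝ := by
    calc ∑ i, L' (b i) * ⟪b i, gradient p x⟫_ℝ
        = L' (∑ i, ⟪b i, gradient p x⟫_ℝ • b i) := by
          simp only [map_sum, map_smul, smul_eq_mul, mul_comm]
      _ = L' (gradient p x) := by rw [b.sum_repr']
      _ = ∑ i, ⟪b i, fderiv ℝ (fderiv ℝ (gradient p)) x (gradient p x) (b i)⟫_ℝ := hL'v _
      _ = ∑ i, ⟪b i, fderiv ℝ (fderiv ℝ (gradient p)) x (b i) (gradient p x)⟫_ℝ :=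
          Finset.sum_congr rfl fun i _ => by rw [hG2sym]
  simp_rw [key]
  rw [Finset.sum_sub_distrib, Finset.sum_add_distrib, Finset.sum_add_distrib, ← Finset.mul_sum,
    ← hLsumx, hcancel]
  ring

/-- Settles item `stmt-NavierStokesRegularity-11742` (`FlatBochnerDivergence`, support of route
`IsobarTomography`): the flat Bochner / Reilly pointwise identity on `ℝ³`,
`div (Δp ∇p − ∇²p ∇p) = (Δp)² − |∇²p|²_F` for `p ∈ C³(ℝ³)`; the special case
`E = EuclideanSpace ℝ (Fin 3)` of
`divergence_laplacian_smul_gradient_sub_hessian_apply_gradient`. [folklore] -/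
theorem isobarTomography_flatBochnerDivergence_proof :
    Summit.NavierStokesRegularity.NavierStokesRegularity.Theses.IsobarTomography.FlatBochnerDivergence := by
  unfold Summit.NavierStokesRegularity.NavierStokesRegularity.Theses.IsobarTomography.FlatBochnerDivergence
  intro p hp x
  exact divergence_laplacian_smul_gradient_sub_hessian_apply_gradient p hp x

end Summit.NavierStokesRegularity.NavierStokesRegularity.Theorems
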